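/-
Copyright (c) 2026. All rights reserved.
Released under Apache 2.0 license as described in the file LICENSE.
Authors: HodgeCM publication cell (pub-hodgecm), GR lane, seat GR-2 (`pub-hodgecm-own-hyp34`).
-/
import Literature.NumberTheory.Weil1964.AdelicSiegelParabolicLift
import Literature.NumberTheory.Weil1964.AdelicMetaplecticKernel
import Literature.NumberTheory.Weil1964.AdelicMetaplecticProductContinuity
import Literature.NumberTheory.Weil1964.AdelicMetaplecticProjSurjective
import HarnessLib

/-!
# Conjugation transports forced lifts: Weil's `𝐫₀` over every CONJUGATE `g P_Y(𝔸) g⁻¹` of the adelic Siegel parabolic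

Topic `NumberTheory/Weil1964`; namespace `Literature.NumberTheory.Weil1964`.  KERNEL MATHEMATICS ONLY: definitions with
bodies and theorems; no `def … : Prop` record, no `axiom`, no proof hole; cite tags are provenance.

THE PRINTED MATHEMATICS.  [Weil1964, Chap. I n° 13 p. 160]: Weil's lift `𝐫₀ = t₀ d₀` of the "parabolic" subgroup
`P₀(G) ⊂ Sp(G)` attached to a polarisation `X ⊕ X*` is a MONOMORPHISM, pinned by the normalisation "value at the
origin" (`(𝐫₀(p)Φ)(0) = Φ(0)`).  [Weil1964, Chap. III n° 36 p. 187; Chap. I n° 4 p. 149]: `Sp(X)` acts on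
everything in sight by transport of structure, `s ↦ 𝐬 s 𝐬⁻¹`; [MoeglinVignerasWaldspurger1987, Chap. 2 II.1 (A)–(B),
II.2]: the group `S̃p_ψ(W)` of pairs `(g, M)` and its tautological representation are natural in the data, and the
Siegel parabolic of ANY complete polarisation `W = Y' ⊕ Y'^*`, `Y' = g Y`, carries the transported lift.  [Kudla1996,
Chap. I §2, Prop. 2.3 and Remark]: "*for a different choice of polarization … the operators are conjugated by the
operator attached to `g`*".  In particular, for every `g ∈ Sp(W_𝔸)` the conjugate parabolic `P_{gY} = g P_Y g⁻¹`
carries a CANONICAL homomorphic lift `x ↦ g̃ 𝐫₀(g⁻¹ x g) g̃⁻¹`, independent of the lift `g̃` of `g` (the kernel of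
`π` is central), characterised as the unique lift whose operators fix the transported functional
`δ₀ ∘ ω(g̃)⁻¹ : Φ ↦ (ω(g̃)⁻¹Φ)(0)`.

USE (recorded, nothing here depends on it): a SPLIT place `v` of a quadratic extension `E/F` (`E_v = F_v × F_v`;
every complex place, the real places above which `E` is real, the finite split places) sees the unitary group
`U(V)(F_v) ≅ GL_n(F_v)` as the Levi factor of the Siegel parabolic of the EIGENSPACE polarisation of `W_v = V_v`,
which is a conjugate `g_v P_Y g_v⁻¹` of the standard one by a `v`-adic symplectic element `g_v` — so this file is the
engine of the split-place sections in a construction of [GelbartRogawski1991, Prop. 3.1.1] for a GENERAL quadratic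
extension `E/F` (the statement-exact typing `Prop311AsPrinted` quantifies over all of them; the tree's
`GRConstruction.gru_shape` is the CM case, which has no split archimedean place).

WHAT IS HERE (all proved):
* §1 GENERIC (`MpPsi ρ` of ANY model `ρ` of a Heisenberg group, ANY functional `Θ : S → X`; continues
  `AdelicMetaplecticGroup` §1): the transported functional **`MpPsi.conjFun q Θ := Θ ∘ M_q⁻¹`** of a pair
  `q = (g, M_q)`; `p` fixes `Θ^q` iff `q⁻¹ p q` fixes `Θ` (`MpPsi.mem_fixing_conjFun_iff`); rigidity transports
  (`ThetaRigid.conjFun`); the liftable subgroup transports by conjugation (`mem_liftable_conjFun_iff`); and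
  **`forcedLift_conjFun`**: the `Θ^q`-forced lift at `g x g⁻¹` is `q · (Θ-forced lift at x) · q⁻¹`.  Packaged for
  consumers as **`forcedLiftAlong hrig q hq j hj`**: for a homomorphism `j : G →* Sp(W)` with every `g⁻¹ j(x) g`
  `Θ`-liftable (`g = π(q)`), the homomorphism `G →* Mp_ψ(W)`, `x ↦ q · forcedLift(g⁻¹ j(x) g) · q⁻¹`
  (`forcedLiftAlong_apply`), over `j` (`proj_forcedLiftAlong`), its values fixing `Θ^q`, its UNIQUENESS among
  homomorphisms over `j` with that property (`eq_forcedLiftAlong(_apply)`), its operators (`toOp_forcedLiftAlong`),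
  and its independence of `q` up to CENTRAL factors (`forcedLiftAlong_eq_of_eq_mul_center`,
  `forcedLiftAlong_eq_of_inv_mul_mem_center`).
* §2 THE ADELIC SIEGEL INSTANCE (`ρ = adelicSchrodinger F (Fin n) T`, `Θ = δ₀`, rigidity
  `deltaRigid_adelicSchrodinger`, liftability `siegelParabolicPi_le_liftable` of `AdelicSiegelParabolicLift`): for
  `g ∈ Sp(W_𝔸)`, a lift `q ∈ Mp_ψ(W_𝔸)ᶜᵒⁿᵗ` of `g` and `j : G →* Sp(W_𝔸)` with `g⁻¹ j(x) g ∈ P_Y(𝔸)`: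
  **`adelicSiegelLiftConj g q hqc hq j hj : G →* Mp_ψ(W_𝔸)ᶜᵒⁿᵗ`** with `π ∘ adelicSiegelLiftConj = j`
  (`proj_adelicSiegelLiftConj`, `proj_comp_adelicSiegelLiftConj`), the formula `= q · 𝐫₀(g⁻¹ j(x) g) · q⁻¹`
  (`coe_adelicSiegelLiftConj_eq`), INDEPENDENCE of the lift `q` of `g` (`adelicSiegelLiftConj_eq_of_proj_eq`: two
  lifts differ by a central scalar, `adelicMpCont.exists_eq_ofScalar_of_proj_eq_one`), the operator formula
  `ω(adelicSiegelLiftConj x) = M_q ∘ ω(𝐫₀(g⁻¹ j(x) g)) ∘ M_q⁻¹` (`toOp_adelicSiegelLiftConj`,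
  `omega_adelicSiegelLiftConj_apply`), the `δ₀ ∘ M_q⁻¹`-normalisation and uniqueness
  (`adelicSiegelLiftConj_mem_fixing`, `evalZero_toOp_symm_omega_adelicSiegelLiftConj`, `eq_adelicSiegelLiftConj`),
  EXISTENCE for every `g` (`exists_section_of_conj_into_siegelParabolicPi`, by `adelicMpCont.proj_surjective`), and
  continuity of the `π`-orbit maps along continuous families (`continuous_mul_const_adelicMp`,
  `continuous_proj_conj_apply`, `continuous_proj_adelicSiegelLiftConj_apply`; the matrix coefficients are
  model-analytic and are treated place by place in the sequels: finite places through `AdelicMetaplecticFinRep`,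
  archimedean ones through Folland's model and `AdelicMetaplecticArchSection.archLift`).

## References

* [Weil1964] A. Weil, *Sur certains groupes d'opérateurs unitaires*, Acta Math. 111 (1964) 143–211: Chap. I n° 4
  p. 149 (transport of structure by `Sp`), n° 13 p. 160 (`d₀`, `t₀`, `𝐫₀` on `P₀(G)`), Chap. III n° 36 p. 187.
* [MoeglinVignerasWaldspurger1987] C. Mœglin, M.-F. Vignéras, J.-L. Waldspurger, *Correspondances de Howe sur un
  corps p-adique*, LNM 1291 (1987), Chap. 2 II.1 (A)–(B), II.2.
* [Kudla1996] S. S. Kudla, *Notes on the local theta correspondence* (1996), Chap. I §2, Prop. 2.3 and the Remark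
  following it (dependence on the polarisation = conjugation).
* [GelbartRogawski1991] S. Gelbart, J. Rogawski, Invent. Math. 105 (1991), §3.1 p. 454 (`Mp_𝐀(W)`, `π`), Prop. 3.1.1
  p. 455 L1–2.
-/

set_option autoImplicit false

noncomputable section

open scoped Matrix
open NumberField
open Literature.RepresentationTheory.HeisenbergGroup
open Literature.NumberTheory.Automorphic
open Literature.GroupTheory.TwistedProduct (fixer mem_fixer_iff)

namespace Literature.NumberTheory.Weil1964

universe u v u' v'

/-! ## §1 Generic: conjugation transports `fixing`, rigidity, `liftable` and the forced lift -/

section Generic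

variable {R : Type u} [CommRing R] [Invertible (2 : R)] {V : Type v} [AddCommGroup V] [Module R V]
  {B : V →ₗ[R] V →ₗ[R] R}
variable {k : Type u'} [CommRing k] {S : Type v'} [AddCommGroup S] [Module k S]
variable (ρ : Representation k (Heisenberg B) S)
variable {X : Type*}

/-- **the transported functional `Θ^q := Θ ∘ M_q⁻¹`** of a pair `q = (g, M_q) ∈ Mp_ψ(W)` ("value at the origin in
the polarisation `g Y`" when `Θ = δ₀`). [cite: Weil1964, Chap. I n° 4 p. 149, n° 13 p. 160] -/
def MpPsi.conjFun (q : MpPsi ρ) (Θ : S → X) : S → X :=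
  fun f => Θ (((q : symplecticGroup B × (S ≃ₗ[k] S)).2)⁻¹ f)

/-- formula. [cite: Weil1964, Chap. I n° 4 p. 149] -/
theorem MpPsi.conjFun_apply (q : MpPsi ρ) (Θ : S → X) (f : S) :
    MpPsi.conjFun ρ q Θ f = Θ (((q : symplecticGroup B × (S ≃ₗ[k] S)).2)⁻¹ f) := rfl

/-- `Θ^1 = Θ`. [cite: Weil1964, Chap. I n° 4 p. 149] -/
@[simp] theorem MpPsi.conjFun_one (Θ : S → X) : MpPsi.conjFun ρ 1 Θ = Θ := by
  funext f
  rw [MpPsi.conjFun_apply, Subgroup.coe_one, Prod.snd_one, inv_one, LinearEquiv.coe_one, id]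

/-- `Θ^{q q'} = (Θ^{q'})^{q}`. [cite: Weil1964, Chap. I n° 4 p. 149] -/
theorem MpPsi.conjFun_mul (q q' : MpPsi ρ) (Θ : S → X) :
    MpPsi.conjFun ρ (q * q') Θ = MpPsi.conjFun ρ q (MpPsi.conjFun ρ q' Θ) := by
  funext f
  simp only [MpPsi.conjFun_apply, Subgroup.coe_mul, Prod.snd_mul, mul_inv_rev, LinearEquiv.mul_apply]

variable {ρ}

/-- **`p` fixes `Θ^q` iff `q⁻¹ p q` fixes `Θ`** — the fixing subgroup of the transported functional is the conjugate
subgroup. [cite: MoeglinVignerasWaldspurger1987, Chap. 2 II.1 (A)–(B)] -/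
theorem MpPsi.mem_fixing_conjFun_iff (q : MpPsi ρ) (Θ : S → X) (p : MpPsi ρ) :
    p ∈ MpPsi.fixing ρ (MpPsi.conjFun ρ q Θ) ↔ q⁻¹ * p * q ∈ MpPsi.fixing ρ Θ := by
  rw [MpPsi.mem_fixing_iff, MpPsi.mem_fixing_iff]
  simp only [MpPsi.conjFun_apply, Subgroup.coe_mul, Subgroup.coe_inv, Prod.snd_mul, Prod.snd_inv,
    LinearEquiv.mul_apply]
  constructor
  · intro h f
    have := h (((q : symplecticGroup B × (S ≃ₗ[k] S)).2) f)
    rwa [LinearEquiv.coe_inv, LinearEquiv.symm_apply_apply] at this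
  · intro h f
    have := h (((q : symplecticGroup B × (S ≃ₗ[k] S)).2)⁻¹ f)
    rwa [← LinearEquiv.mul_apply ((q : symplecticGroup B × (S ≃ₗ[k] S)).2), mul_inv_cancel,
      LinearEquiv.coe_one, id] at this

/-- the same, read as `q x q⁻¹` fixes `Θ^q` iff `x` fixes `Θ`. [cite: MoeglinVignerasWaldspurger1987, Chap. 2 II.1 (A)–(B)] -/
theorem MpPsi.conj_mem_fixing_conjFun_iff (q : MpPsi ρ) (Θ : S → X) (x : MpPsi ρ) :
    q * x * q⁻¹ ∈ MpPsi.fixing ρ (MpPsi.conjFun ρ q Θ) ↔ x ∈ MpPsi.fixing ρ Θ := by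
  rw [MpPsi.mem_fixing_conjFun_iff, ← mul_assoc, ← mul_assoc, inv_mul_cancel, one_mul, inv_mul_cancel_right]

/-- a bare automorphism `C` of `S` commutes with `ρ(H)` iff `(1, C)` is a pair. [cite: MoeglinVignerasWaldspurger1987, Chap. 2 II.1 (A)] -/
theorem one_prod_mem_MpPsi_iff (C : S ≃ₗ[k] S) :
    ((1 : symplecticGroup B), C) ∈ MpPsi ρ ↔ ∀ (h : Heisenberg B) (f : S), C (ρ h f) = ρ h (C f) := by
  rw [mem_MpPsi, map_one, implements_iff]
  simp only [Heisenberg.PseudoSymplectic.act_one]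

/-- **RIGIDITY TRANSPORTS**: if `Θ` is rigid for `ρ` then so is `Θ^q` for every pair `q` (conjugate the candidate
automorphism back by `M_q`). [cite: Weil1964, Chap. III n° 41 Thm 6 p. 193] -/
theorem ThetaRigid.conjFun {Θ : S → X} (hrig : ThetaRigid ρ Θ) (q : MpPsi ρ) :
    ThetaRigid ρ (MpPsi.conjFun ρ q Θ) := by
  intro C hC hΘ
  -- the pair `c = (1, C)` and its conjugate `q⁻¹ c q = (1, M_q⁻¹ C M_q)`
  set c : MpPsi ρ := ⟨((1 : symplecticGroup B), C), (one_prod_mem_MpPsi_iff C).2 hC⟩ with hc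
  have hcfix : c ∈ MpPsi.fixing ρ (MpPsi.conjFun ρ q Θ) := by
    rw [MpPsi.mem_fixing_iff]
    intro f
    exact (mem_fixer_iff _ C).1 hΘ f
  have hconj : q⁻¹ * c * q ∈ MpPsi.fixing ρ Θ := (MpPsi.mem_fixing_conjFun_iff q Θ c).1 hcfix
  have hproj : ((q⁻¹ * c * q : MpPsi ρ) : symplecticGroup B × (S ≃ₗ[k] S)).1 = 1 := by
    simp only [Subgroup.coe_mul, Subgroup.coe_inv, Prod.fst_mul, Prod.fst_inv, hc, mul_one, inv_mul_cancel]
  have hcomm : ∀ (h : Heisenberg B) (f : S),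
      ((q⁻¹ * c * q : MpPsi ρ) : symplecticGroup B × (S ≃ₗ[k] S)).2 (ρ h f) =
        ρ h (((q⁻¹ * c * q : MpPsi ρ) : symplecticGroup B × (S ≃ₗ[k] S)).2 f) := by
    have hm : (((q⁻¹ * c * q : MpPsi ρ) : symplecticGroup B × (S ≃ₗ[k] S)).1,
        ((q⁻¹ * c * q : MpPsi ρ) : symplecticGroup B × (S ≃ₗ[k] S)).2) ∈ MpPsi ρ := (q⁻¹ * c * q).2
    rw [hproj, one_prod_mem_MpPsi_iff] at hm
    exact hm
  have hfix : ((q⁻¹ * c * q : MpPsi ρ) : symplecticGroup B × (S ≃ₗ[k] S)).2 ∈ fixer (MpPsi.conjFun ρ 1 Θ) := by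
    rw [MpPsi.conjFun_one, mem_fixer_iff]
    intro f
    rw [LinearEquiv.smul_def]
    exact (MpPsi.mem_fixing_iff ρ Θ _).1 hconj f
  rw [MpPsi.conjFun_one] at hfix
  have h1 := hrig _ hcomm hfix
  -- `M_q⁻¹ C M_q = 1` forces `C = 1`
  have h2 : ((q⁻¹ * c * q : MpPsi ρ) : symplecticGroup B × (S ≃ₗ[k] S)).2 =
      ((q : symplecticGroup B × (S ≃ₗ[k] S)).2)⁻¹ * C * (q : symplecticGroup B × (S ≃ₗ[k] S)).2 := by
    simp only [Subgroup.coe_mul, Subgroup.coe_inv, Prod.snd_mul, Prod.snd_inv, hc]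
  rw [h2] at h1
  have h3 : C = (q : symplecticGroup B × (S ≃ₗ[k] S)).2 * 1 * ((q : symplecticGroup B × (S ≃ₗ[k] S)).2)⁻¹ := by
    rw [← h1]; group
  rw [h3, mul_one, mul_inv_cancel]

variable (ρ)

/-- **the liftable subgroup transports by conjugation**: `x` is `Θ^q`-liftable iff `g⁻¹ x g` is `Θ`-liftable,
`g = π(q)`. [cite: Weil1964, Chap. III n° 40 p. 190] -/
theorem mem_liftable_conjFun_iff (q : MpPsi ρ) (Θ : S → X) (x : symplecticGroup B) :
    x ∈ liftable ρ (MpPsi.conjFun ρ q Θ) ↔ (MpPsi.proj ρ q)⁻¹ * x * MpPsi.proj ρ q ∈ liftable ρ Θ := by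
  rw [mem_liftable_iff, mem_liftable_iff]
  constructor
  · rintro ⟨p, hp, rfl⟩
    exact ⟨q⁻¹ * p * q, (MpPsi.mem_fixing_conjFun_iff q Θ p).1 hp, by rw [map_mul, map_mul, map_inv]⟩
  · rintro ⟨p, hp, hpx⟩
    refine ⟨q * p * q⁻¹, (MpPsi.conj_mem_fixing_conjFun_iff q Θ p).2 hp, ?_⟩
    rw [map_mul, map_mul, map_inv, hpx]
    group

/-- in particular `g x g⁻¹` is `Θ^q`-liftable for `Θ`-liftable `x`. [cite: Weil1964, Chap. III n° 40 p. 190] -/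
theorem conj_mem_liftable_conjFun (q : MpPsi ρ) (Θ : S → X) {x : symplecticGroup B} (hx : x ∈ liftable ρ Θ) :
    MpPsi.proj ρ q * x * (MpPsi.proj ρ q)⁻¹ ∈ liftable ρ (MpPsi.conjFun ρ q Θ) := by
  rw [mem_liftable_conjFun_iff]
  simpa only [← mul_assoc, inv_mul_cancel, one_mul, inv_mul_cancel_right] using hx

variable {ρ}

/-- **THE FORCED LIFT TRANSPORTS**: the `Θ^q`-forced lift at `g x g⁻¹` is `q · (Θ-forced lift at x) · q⁻¹` — Weil's
`𝐫₀` read in the polarisation `g Y` is the conjugate of `𝐫₀`. [cite: Weil1964, Chap. I n° 13 p. 160; Chap. III n° 36 p. 187] -/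
theorem forcedLift_conjFun {Θ : S → X} (hrig : ThetaRigid ρ Θ) (q : MpPsi ρ) (x : liftable ρ Θ) :
    forcedLift (hrig.conjFun q) ⟨MpPsi.proj ρ q * x * (MpPsi.proj ρ q)⁻¹, conj_mem_liftable_conjFun ρ q Θ x.2⟩ =
      q * forcedLift hrig x * q⁻¹ := by
  symm
  have hfix : q * forcedLift hrig x * q⁻¹ ∈ MpPsi.fixing ρ (MpPsi.conjFun ρ q Θ) :=
    (MpPsi.conj_mem_fixing_conjFun_iff q Θ _).2 (forcedLift_mem_fixing hrig x)
  refine MpPsi.eq_of_proj_eq_of_mem_fixing (hrig.conjFun q) hfix (forcedLift_mem_fixing _ _) ?_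
  rw [proj_forcedLift, map_mul, map_mul, map_inv, proj_forcedLift]

/-! ### Packaging: the transported lift along a homomorphism `j : G →* Sp(W)` -/

variable {G : Type*} [Group G]

/-- the symplectic map `x ↦ j x` with values in the `Θ^q`-liftable subgroup, when `g⁻¹ j(x) g` is `Θ`-liftable,
`g = π(q)`. [cite: Weil1964, Chap. III n° 40 p. 190] -/
def liftableAlong (q : MpPsi ρ) (Θ : S → X) {g : symplecticGroup B} (hq : MpPsi.proj ρ q = g)
    (j : G →* symplecticGroup B) (hj : ∀ x : G, g⁻¹ * j x * g ∈ liftable ρ Θ) :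
    G →* liftable ρ (MpPsi.conjFun ρ q Θ) :=
  j.codRestrict _ fun x => (mem_liftable_conjFun_iff ρ q Θ (j x)).2 (by rw [hq]; exact hj x)

/-- formula. [cite: Weil1964, Chap. III n° 40 p. 190] -/
@[simp] theorem coe_liftableAlong_apply (q : MpPsi ρ) (Θ : S → X) {g : symplecticGroup B}
    (hq : MpPsi.proj ρ q = g) (j : G →* symplecticGroup B) (hj : ∀ x : G, g⁻¹ * j x * g ∈ liftable ρ Θ) (x : G) :
    (liftableAlong q Θ hq j hj x : symplecticGroup B) = j x := rfl

/-- **`forcedLiftAlong`**: for a rigid `Θ`, a pair `q` over `g` and a homomorphism `j : G →* Sp(W)` with every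
`g⁻¹ j(x) g` `Θ`-liftable, the homomorphism `G →* Mp_ψ(W)`, `x ↦ q · forcedLift(g⁻¹ j(x) g) · q⁻¹` (defined as the
`Θ^q`-forced lift of `j x`). [cite: Weil1964, Chap. I n° 13 p. 160; Chap. III n° 40 p. 190] -/
def forcedLiftAlong {Θ : S → X} (hrig : ThetaRigid ρ Θ) (q : MpPsi ρ) {g : symplecticGroup B}
    (hq : MpPsi.proj ρ q = g) (j : G →* symplecticGroup B) (hj : ∀ x : G, g⁻¹ * j x * g ∈ liftable ρ Θ) :
    G →* MpPsi ρ :=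
  (forcedLift (hrig.conjFun q)).comp (liftableAlong q Θ hq j hj)

/-- `π ∘ forcedLiftAlong = j`. [cite: Weil1964, Chap. III n° 40 p. 190] -/
@[simp] theorem proj_forcedLiftAlong {Θ : S → X} (hrig : ThetaRigid ρ Θ) (q : MpPsi ρ) {g : symplecticGroup B}
    (hq : MpPsi.proj ρ q = g) (j : G →* symplecticGroup B) (hj : ∀ x : G, g⁻¹ * j x * g ∈ liftable ρ Θ) (x : G) :
    MpPsi.proj ρ (forcedLiftAlong hrig q hq j hj x) = j x := by
  rw [forcedLiftAlong, MonoidHom.comp_apply, proj_forcedLift, coe_liftableAlong_apply]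

/-- the values of `forcedLiftAlong` fix `Θ^q`. [cite: Weil1964, Chap. III n° 41 Thm 6 p. 193] -/
theorem forcedLiftAlong_mem_fixing {Θ : S → X} (hrig : ThetaRigid ρ Θ) (q : MpPsi ρ) {g : symplecticGroup B}
    (hq : MpPsi.proj ρ q = g) (j : G →* symplecticGroup B) (hj : ∀ x : G, g⁻¹ * j x * g ∈ liftable ρ Θ) (x : G) :
    forcedLiftAlong hrig q hq j hj x ∈ MpPsi.fixing ρ (MpPsi.conjFun ρ q Θ) :=
  forcedLift_mem_fixing (hrig.conjFun q) (liftableAlong q Θ hq j hj x)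

/-- **THE CONJUGATION FORMULA** `forcedLiftAlong x = q · forcedLift(g⁻¹ j(x) g) · q⁻¹`.
[cite: Weil1964, Chap. I n° 13 p. 160; Chap. III n° 36 p. 187] -/
theorem forcedLiftAlong_apply {Θ : S → X} (hrig : ThetaRigid ρ Θ) (q : MpPsi ρ) {g : symplecticGroup B}
    (hq : MpPsi.proj ρ q = g) (j : G →* symplecticGroup B) (hj : ∀ x : G, g⁻¹ * j x * g ∈ liftable ρ Θ) (x : G) :
    forcedLiftAlong hrig q hq j hj x = q * forcedLift hrig ⟨g⁻¹ * j x * g, hj x⟩ * q⁻¹ := by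
  subst hq
  rw [forcedLiftAlong, MonoidHom.comp_apply,
    ← forcedLift_conjFun hrig q ⟨(MpPsi.proj ρ q)⁻¹ * j x * MpPsi.proj ρ q, hj x⟩]
  congr 1
  apply Subtype.ext
  rw [coe_liftableAlong_apply]
  group

/-- **UNIQUENESS**: a homomorphism `s : G →* Mp_ψ(W)` over `j` whose value at `x` fixes `Θ^q` agrees there with
`forcedLiftAlong`. [cite: Weil1964, Chap. III n° 41 Thm 6 p. 193] -/
theorem eq_forcedLiftAlong_apply {Θ : S → X} (hrig : ThetaRigid ρ Θ) (q : MpPsi ρ) {g : symplecticGroup B}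
    (hq : MpPsi.proj ρ q = g) (j : G →* symplecticGroup B) (hj : ∀ x : G, g⁻¹ * j x * g ∈ liftable ρ Θ)
    (s : G →* MpPsi ρ) {x : G} (hsx : s x ∈ MpPsi.fixing ρ (MpPsi.conjFun ρ q Θ))
    (hproj : MpPsi.proj ρ (s x) = j x) : s x = forcedLiftAlong hrig q hq j hj x :=
  MpPsi.eq_of_proj_eq_of_mem_fixing (hrig.conjFun q) hsx (forcedLiftAlong_mem_fixing hrig q hq j hj x)
    (by rw [hproj, proj_forcedLiftAlong])

/-- uniqueness as homomorphisms: if every value of `s` over `j` fixes `Θ^q` then `s = forcedLiftAlong`.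
[cite: Weil1964, Chap. III n° 41 Thm 6 p. 193] -/
theorem eq_forcedLiftAlong {Θ : S → X} (hrig : ThetaRigid ρ Θ) (q : MpPsi ρ) {g : symplecticGroup B}
    (hq : MpPsi.proj ρ q = g) (j : G →* symplecticGroup B) (hj : ∀ x : G, g⁻¹ * j x * g ∈ liftable ρ Θ)
    (s : G →* MpPsi ρ) (hs : ∀ x, s x ∈ MpPsi.fixing ρ (MpPsi.conjFun ρ q Θ))
    (hproj : ∀ x, MpPsi.proj ρ (s x) = j x) : s = forcedLiftAlong hrig q hq j hj :=
  MonoidHom.ext fun x => eq_forcedLiftAlong_apply hrig q hq j hj s (hs x) (hproj x)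

/-- **INDEPENDENCE OF THE LIFT up to the centre**: if `q' = q z` with `z` CENTRAL in `Mp_ψ(W)` (e.g. `z ∈ ker π`
when the model is irreducible), the transported lifts for `q` and `q'` coincide.
[cite: MoeglinVignerasWaldspurger1987, Chap. 2 II.1 (B)] -/
theorem forcedLiftAlong_eq_of_eq_mul_center {Θ : S → X} (hrig : ThetaRigid ρ Θ) (q q' z : MpPsi ρ)
    (hz : z ∈ Subgroup.center (MpPsi ρ)) (he : q' = q * z) {g : symplecticGroup B} (hq : MpPsi.proj ρ q = g)
    (hq' : MpPsi.proj ρ q' = g) (j : G →* symplecticGroup B) (hj : ∀ x : G, g⁻¹ * j x * g ∈ liftable ρ Θ) :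
    forcedLiftAlong hrig q' hq' j hj = forcedLiftAlong hrig q hq j hj := by
  subst he
  ext x : 1
  rw [forcedLiftAlong_apply, forcedLiftAlong_apply]
  have hzc : ∀ y, y * z = z * y := Subgroup.mem_center_iff.1 hz
  calc q * z * forcedLift hrig ⟨g⁻¹ * j x * g, hj x⟩ * (q * z)⁻¹
      = q * (z * forcedLift hrig ⟨g⁻¹ * j x * g, hj x⟩) * (z⁻¹ * q⁻¹) := by
        simp only [mul_assoc, mul_inv_rev]
    _ = q * (forcedLift hrig ⟨g⁻¹ * j x * g, hj x⟩ * z) * (z⁻¹ * q⁻¹) := by rw [hzc]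
    _ = q * forcedLift hrig ⟨g⁻¹ * j x * g, hj x⟩ * q⁻¹ := by
        simp only [mul_assoc, mul_inv_cancel_left]

/-- two pairs over the same `g` have quotient over `1`. [cite: MoeglinVignerasWaldspurger1987, Chap. 2 II.1 (B)] -/
theorem MpPsi.proj_inv_mul_eq_one (q q' : MpPsi ρ) {g : symplecticGroup B} (hq : MpPsi.proj ρ q = g)
    (hq' : MpPsi.proj ρ q' = g) : MpPsi.proj ρ (q⁻¹ * q') = 1 := by
  rw [map_mul, map_inv, hq, hq', inv_mul_cancel]

/-- independence of the lift, quotient form: if `q⁻¹ q'` is central the transported lifts for `q`, `q'` over the same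
`g` coincide. [cite: MoeglinVignerasWaldspurger1987, Chap. 2 II.1 (B)] -/
theorem forcedLiftAlong_eq_of_inv_mul_mem_center {Θ : S → X} (hrig : ThetaRigid ρ Θ) (q q' : MpPsi ρ)
    (hz : q⁻¹ * q' ∈ Subgroup.center (MpPsi ρ)) {g : symplecticGroup B} (hq : MpPsi.proj ρ q = g)
    (hq' : MpPsi.proj ρ q' = g) (j : G →* symplecticGroup B) (hj : ∀ x : G, g⁻¹ * j x * g ∈ liftable ρ Θ) :
    forcedLiftAlong hrig q' hq' j hj = forcedLiftAlong hrig q hq j hj :=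
  forcedLiftAlong_eq_of_eq_mul_center hrig q q' (q⁻¹ * q') hz (mul_inv_cancel_left q q').symm hq hq' j hj

/-- the operator of `forcedLiftAlong x` is `M_q ∘ (operator of the forced lift at g⁻¹ j(x) g) ∘ M_q⁻¹`.
[cite: MoeglinVignerasWaldspurger1987, Chap. 2 II.1 (B)] -/
theorem toOp_forcedLiftAlong {Θ : S → X} (hrig : ThetaRigid ρ Θ) (q : MpPsi ρ) {g : symplecticGroup B}
    (hq : MpPsi.proj ρ q = g) (j : G →* symplecticGroup B) (hj : ∀ x : G, g⁻¹ * j x * g ∈ liftable ρ Θ) (x : G) :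
    MpPsi.toOp ρ (forcedLiftAlong hrig q hq j hj x) =
      MpPsi.toOp ρ q * MpPsi.toOp ρ (forcedLift hrig ⟨g⁻¹ * j x * g, hj x⟩) * (MpPsi.toOp ρ q)⁻¹ := by
  rw [forcedLiftAlong_apply, map_mul, map_mul, map_inv]

end Generic

/-! ## §2 The adelic Siegel instance: `𝐫₀` on a conjugate parabolic `g P_Y(𝔸) g⁻¹` -/

section Adelic

variable (F : Type) [Field F] [NumberField F] {n : ℕ}
variable (T : Matrix (Fin n) (Fin n) (AdeleRing (𝓞 F) F)) (hT : IsUnit T.det)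

local notation "𝔸F" => AdeleRing (𝓞 F) F
local notation "𝕎𝔸" => (Fin n → AdeleRing (𝓞 F) F) × (Fin n → AdeleRing (𝓞 F) F)
local notation "Sp𝔸" => symplecticGroup (polar (adelicForm F (Fin n) T))

variable {G : Type*} [Group G]

variable {F T}

include hT

/-- `𝐫₀ = adelicSiegelLift` IS the `δ₀`-forced lift (unfolding of its definition in `AdelicSiegelParabolicLift`).
[cite: Weil1964, Chap. I n° 13 p. 160] -/
theorem adelicSiegelLift_eq_forcedLift (p : siegelParabolicPi T) :
    adelicSiegelLift F T hT p =
      forcedLift (deltaRigid_adelicSchrodinger F (Fin n) T) ⟨(p : Sp𝔸), siegelParabolicPi_le_liftable F T hT p.2⟩ :=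
  rfl

/-! DATA for the rest of the section: `g ∈ Sp(W_𝔸)`; a pair `q ∈ Mp_ψ(W_𝔸)` over `g` (`hq`) lying in the group of
record `Mp_ψ(W_𝔸)ᶜᵒⁿᵗ` (`hqc`; such `q` exist for every `g`, `adelicMpCont.proj_surjective`); a homomorphism
`j : G →* Sp(W_𝔸)` with `g⁻¹ j(x) g ∈ P_Y(𝔸)` (`hj`). -/

/-- the transported lift in `Mp_ψ(W_𝔸)`: `x ↦ q · 𝐫₀(g⁻¹ j(x) g) · q⁻¹`.
[cite: Weil1964, Chap. I n° 13 p. 160; Chap. III n° 36 p. 187] -/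
def adelicSiegelLiftConj' (g : Sp𝔸) (q : adelicMp F (Fin n) T) (hq : MpPsi.proj _ q = g)
    (j : G →* Sp𝔸) (hj : ∀ x : G, g⁻¹ * j x * g ∈ siegelParabolicPi T) : G →* adelicMp F (Fin n) T :=
  forcedLiftAlong (deltaRigid_adelicSchrodinger F (Fin n) T) q hq j fun x => siegelParabolicPi_le_liftable F T hT (hj x)

/-- **formula**: `adelicSiegelLiftConj' x = q · 𝐫₀(g⁻¹ j(x) g) · q⁻¹` with Weil's `𝐫₀ = adelicSiegelLift` of
`AdelicSiegelParabolicLift`. [cite: Weil1964, Chap. I n° 13 p. 160; Chap. III n° 36 p. 187] -/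
theorem adelicSiegelLiftConj'_apply (g : Sp𝔸) (q : adelicMp F (Fin n) T) (hq : MpPsi.proj _ q = g)
    (j : G →* Sp𝔸) (hj : ∀ x : G, g⁻¹ * j x * g ∈ siegelParabolicPi T) (x : G) :
    adelicSiegelLiftConj' hT g q hq j hj x = q * adelicSiegelLift F T hT ⟨g⁻¹ * j x * g, hj x⟩ * q⁻¹ :=
  forcedLiftAlong_apply (deltaRigid_adelicSchrodinger F (Fin n) T) q hq j _ x

/-- `π ∘ adelicSiegelLiftConj' = j`. [cite: Weil1964, Chap. I n° 13 p. 160] -/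
@[simp] theorem proj_adelicSiegelLiftConj' (g : Sp𝔸) (q : adelicMp F (Fin n) T) (hq : MpPsi.proj _ q = g)
    (j : G →* Sp𝔸) (hj : ∀ x : G, g⁻¹ * j x * g ∈ siegelParabolicPi T) (x : G) :
    MpPsi.proj _ (adelicSiegelLiftConj' hT g q hq j hj x) = j x :=
  proj_forcedLiftAlong (deltaRigid_adelicSchrodinger F (Fin n) T) q hq j _ x

/-- with `q` in the group of record the values lie in the group of record `Mp_ψ(W_𝔸)ᶜᵒⁿᵗ` (`𝐫₀` does,
`adelicSiegelLift_mem_adelicMpCont`). [cite: Weil1964, Chap. I n° 11 p. 158] -/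
theorem adelicSiegelLiftConj'_mem_adelicMpCont (g : Sp𝔸) (q : adelicMp F (Fin n) T)
    (hqc : q ∈ adelicMpCont F (Fin n) T) (hq : MpPsi.proj _ q = g)
    (j : G →* Sp𝔸) (hj : ∀ x : G, g⁻¹ * j x * g ∈ siegelParabolicPi T) (x : G) :
    adelicSiegelLiftConj' hT g q hq j hj x ∈ adelicMpCont F (Fin n) T := by
  rw [adelicSiegelLiftConj'_apply]
  exact Subgroup.mul_mem _ (Subgroup.mul_mem _ hqc (adelicSiegelLift_mem_adelicMpCont F T hT _))
    (Subgroup.inv_mem _ hqc)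

/-- **`adelicSiegelLiftConj g q hqc hq j hj : G →* Mp_ψ(W_𝔸)ᶜᵒⁿᵗ`** — Weil's `𝐫₀` TRANSPORTED to the conjugate
parabolic `g P_Y(𝔸) g⁻¹ ⊇ j(G)`: `x ↦ q · 𝐫₀(g⁻¹ j(x) g) · q⁻¹` for a lift `q ∈ Mp_ψ(W_𝔸)ᶜᵒⁿᵗ` of `g` (any:
`adelicSiegelLiftConj_eq_of_proj_eq`; one exists: `adelicMpCont.proj_surjective`).
[cite: Weil1964, Chap. I n° 13 p. 160; Chap. III n° 36 p. 187] -/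
def adelicSiegelLiftConj (g : Sp𝔸) (q : adelicMp F (Fin n) T) (hqc : q ∈ adelicMpCont F (Fin n) T)
    (hq : MpPsi.proj _ q = g) (j : G →* Sp𝔸) (hj : ∀ x : G, g⁻¹ * j x * g ∈ siegelParabolicPi T) :
    G →* adelicMpCont F (Fin n) T :=
  (adelicSiegelLiftConj' hT g q hq j hj).codRestrict _ (adelicSiegelLiftConj'_mem_adelicMpCont hT g q hqc hq j hj)

/-- underlying pair. [cite: Weil1964, Chap. I n° 13 p. 160] -/
@[simp] theorem coe_adelicSiegelLiftConj (g : Sp𝔸) (q : adelicMp F (Fin n) T) (hqc : q ∈ adelicMpCont F (Fin n) T)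
    (hq : MpPsi.proj _ q = g) (j : G →* Sp𝔸) (hj : ∀ x : G, g⁻¹ * j x * g ∈ siegelParabolicPi T) (x : G) :
    (adelicSiegelLiftConj hT g q hqc hq j hj x : adelicMp F (Fin n) T) = adelicSiegelLiftConj' hT g q hq j hj x :=
  rfl

/-- **`π ∘ adelicSiegelLiftConj = j`**: a homomorphic section over `j(G) ⊆ g P_Y(𝔸) g⁻¹`, in the group of record.
[cite: Weil1964, Chap. I n° 13 p. 160] -/
@[simp] theorem proj_adelicSiegelLiftConj (g : Sp𝔸) (q : adelicMp F (Fin n) T)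
    (hqc : q ∈ adelicMpCont F (Fin n) T) (hq : MpPsi.proj _ q = g) (j : G →* Sp𝔸)
    (hj : ∀ x : G, g⁻¹ * j x * g ∈ siegelParabolicPi T) (x : G) :
    adelicMpCont.proj F (Fin n) T (adelicSiegelLiftConj hT g q hqc hq j hj x) = j x :=
  proj_forcedLiftAlong (deltaRigid_adelicSchrodinger F (Fin n) T) q hq j _ x

/-- `π ∘ adelicSiegelLiftConj = j` as homomorphisms. [cite: Weil1964, Chap. I n° 13 p. 160] -/
theorem proj_comp_adelicSiegelLiftConj (g : Sp𝔸) (q : adelicMp F (Fin n) T)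
    (hqc : q ∈ adelicMpCont F (Fin n) T) (hq : MpPsi.proj _ q = g) (j : G →* Sp𝔸)
    (hj : ∀ x : G, g⁻¹ * j x * g ∈ siegelParabolicPi T) :
    (adelicMpCont.proj F (Fin n) T).comp (adelicSiegelLiftConj hT g q hqc hq j hj) = j :=
  MonoidHom.ext fun x => proj_adelicSiegelLiftConj hT g q hqc hq j hj x

/-- **the conjugation formula, read in `Mp_ψ(W_𝔸)`**: `↑(adelicSiegelLiftConj x) = q · 𝐫₀(g⁻¹ j(x) g) · q⁻¹`.
[cite: Weil1964, Chap. I n° 13 p. 160; Chap. III n° 36 p. 187] -/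
theorem coe_adelicSiegelLiftConj_eq (g : Sp𝔸) (q : adelicMp F (Fin n) T) (hqc : q ∈ adelicMpCont F (Fin n) T)
    (hq : MpPsi.proj _ q = g) (j : G →* Sp𝔸) (hj : ∀ x : G, g⁻¹ * j x * g ∈ siegelParabolicPi T) (x : G) :
    (adelicSiegelLiftConj hT g q hqc hq j hj x : adelicMp F (Fin n) T) =
      q * adelicSiegelLift F T hT ⟨g⁻¹ * j x * g, hj x⟩ * q⁻¹ :=
  adelicSiegelLiftConj'_apply hT g q hq j hj x

/-- **INDEPENDENCE OF THE LIFT `q` OF `g`**: two elements of `Mp_ψ(W_𝔸)ᶜᵒⁿᵗ` over the same `g` differ by a central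
scalar `(1, c·id)` (`adelicMpCont.exists_eq_ofScalar_of_proj_eq_one`), so they give the same transported section.
[cite: MoeglinVignerasWaldspurger1987, Chap. 2 II.1 (B)] -/
theorem adelicSiegelLiftConj'_eq_of_proj_eq (hT' : IsUnit T) (g : Sp𝔸) (q q' : adelicMp F (Fin n) T)
    (hqc : q ∈ adelicMpCont F (Fin n) T) (hqc' : q' ∈ adelicMpCont F (Fin n) T)
    (hq : MpPsi.proj _ q = g) (hq' : MpPsi.proj _ q' = g)
    (j : G →* Sp𝔸) (hj : ∀ x : G, g⁻¹ * j x * g ∈ siegelParabolicPi T) :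
    adelicSiegelLiftConj' hT g q' hq' j hj = adelicSiegelLiftConj' hT g q hq j hj := by
  -- `z := q⁻¹ q' ∈ Mp_ψ(W_𝔸)ᶜᵒⁿᵗ` lies over `1`, hence is a central scalar `(1, c·id)`
  have hzc : q⁻¹ * q' ∈ adelicMpCont F (Fin n) T := Subgroup.mul_mem _ (Subgroup.inv_mem _ hqc) hqc'
  have hz1 : adelicMpCont.proj F (Fin n) T ⟨q⁻¹ * q', hzc⟩ = 1 := MpPsi.proj_inv_mul_eq_one q q' hq hq'
  refine (adelicMpCont.exists_eq_ofScalar_of_proj_eq_one hT' ⟨q⁻¹ * q', hzc⟩ hz1).elim fun c hc => ?_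
  have e : q⁻¹ * q' = MpPsi.ofScalar (adelicSchrodinger F (Fin n) T) c := congrArg Subtype.val hc
  exact forcedLiftAlong_eq_of_inv_mul_mem_center (deltaRigid_adelicSchrodinger F (Fin n) T) q q'
    (e ▸ MpPsi.ofScalar_mem_center _ c) hq hq' j _

/-- the same in the group of record. [cite: MoeglinVignerasWaldspurger1987, Chap. 2 II.1 (B)] -/
theorem adelicSiegelLiftConj_eq_of_proj_eq (hT' : IsUnit T) (g : Sp𝔸) (q q' : adelicMp F (Fin n) T)
    (hqc : q ∈ adelicMpCont F (Fin n) T) (hqc' : q' ∈ adelicMpCont F (Fin n) T)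
    (hq : MpPsi.proj _ q = g) (hq' : MpPsi.proj _ q' = g)
    (j : G →* Sp𝔸) (hj : ∀ x : G, g⁻¹ * j x * g ∈ siegelParabolicPi T) :
    adelicSiegelLiftConj hT g q' hqc' hq' j hj = adelicSiegelLiftConj hT g q hqc hq j hj := by
  have h := adelicSiegelLiftConj'_eq_of_proj_eq hT hT' g q q' hqc hqc' hq hq' j hj
  ext x : 1
  apply Subtype.ext
  exact DFunLike.congr_fun h x

/-- **the operator formula**: `ω(adelicSiegelLiftConj x) = M_q ∘ ω(𝐫₀(g⁻¹ j(x) g)) ∘ M_q⁻¹` (operators of pairs);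
with `coe_toOp_adelicSiegelLift_symm` this is `Φ ↦ M_q [u ↦ ψ_F(½ β_T(u', v')) (M_q⁻¹Φ)(u')]`,
`(u', v') = p⁻¹(u, 0)`, `p = g⁻¹ j(x) g`. [cite: Weil1964, Chap. I n° 13 p. 160; Kudla1996, Chap. I §2 Prop. 2.3] -/
theorem toOp_adelicSiegelLiftConj (g : Sp𝔸) (q : adelicMp F (Fin n) T) (hqc : q ∈ adelicMpCont F (Fin n) T)
    (hq : MpPsi.proj _ q = g) (j : G →* Sp𝔸) (hj : ∀ x : G, g⁻¹ * j x * g ∈ siegelParabolicPi T) (x : G) :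
    MpPsi.toOp (adelicSchrodinger F (Fin n) T) (adelicSiegelLiftConj hT g q hqc hq j hj x : adelicMp F (Fin n) T) =
      MpPsi.toOp (adelicSchrodinger F (Fin n) T) q *
        MpPsi.toOp (adelicSchrodinger F (Fin n) T) (adelicSiegelLift F T hT ⟨g⁻¹ * j x * g, hj x⟩) *
        (MpPsi.toOp (adelicSchrodinger F (Fin n) T) q)⁻¹ :=
  toOp_forcedLiftAlong (deltaRigid_adelicSchrodinger F (Fin n) T) q hq j _ x

/-- the operator formula on a vector: `ω(adelicSiegelLiftConj x) Φ = M_q (ω(𝐫₀(g⁻¹ j(x) g)) (M_q⁻¹ Φ))`.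
[cite: Weil1964, Chap. I n° 13 p. 160; Kudla1996, Chap. I §2 Prop. 2.3] -/
theorem omega_adelicSiegelLiftConj_apply (g : Sp𝔸) (q : adelicMp F (Fin n) T) (hqc : q ∈ adelicMpCont F (Fin n) T)
    (hq : MpPsi.proj _ q = g) (j : G →* Sp𝔸) (hj : ∀ x : G, g⁻¹ * j x * g ∈ siegelParabolicPi T) (x : G)
    (Φ : piSchwartzBruhat F (Fin n)) :
    adelicMpCont.omega F (Fin n) T (adelicSiegelLiftConj hT g q hqc hq j hj x) Φ =
      MpPsi.toOp (adelicSchrodinger F (Fin n) T) q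
        (MpPsi.toOp (adelicSchrodinger F (Fin n) T) (adelicSiegelLift F T hT ⟨g⁻¹ * j x * g, hj x⟩)
          ((MpPsi.toOp (adelicSchrodinger F (Fin n) T) q)⁻¹ Φ)) := by
  have h := congrArg (fun M : piSchwartzBruhat F (Fin n) ≃ₗ[ℂ] piSchwartzBruhat F (Fin n) => M Φ)
    (toOp_adelicSiegelLiftConj hT g q hqc hq j hj x)
  simpa only [adelicMpCont.omega_apply, omegaPsi_apply, MpPsi.toOp_apply, LinearEquiv.mul_apply] using h

/-- **NORMALISATION**: the operators of `adelicSiegelLiftConj` fix the transported functional `δ₀ ∘ M_q⁻¹`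
("value at the origin in the polarisation `g Y`"). [cite: Weil1964, Chap. I n° 13 p. 160] -/
theorem adelicSiegelLiftConj_mem_fixing (g : Sp𝔸) (q : adelicMp F (Fin n) T) (hqc : q ∈ adelicMpCont F (Fin n) T)
    (hq : MpPsi.proj _ q = g) (j : G →* Sp𝔸) (hj : ∀ x : G, g⁻¹ * j x * g ∈ siegelParabolicPi T) (x : G) :
    (adelicSiegelLiftConj hT g q hqc hq j hj x : adelicMp F (Fin n) T) ∈
      MpPsi.fixing (adelicSchrodinger F (Fin n) T)
        (MpPsi.conjFun (adelicSchrodinger F (Fin n) T) q (evalZeroLM F (Fin n) : piSchwartzBruhat F (Fin n) → ℂ)) :=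
  forcedLiftAlong_mem_fixing (deltaRigid_adelicSchrodinger F (Fin n) T) q hq j _ x

/-- the normalisation, unfolded: `(M_q⁻¹ (ω(adelicSiegelLiftConj x) Φ))(0) = (M_q⁻¹ Φ)(0)` for every `Φ`.
[cite: Weil1964, Chap. I n° 13 p. 160] -/
theorem evalZero_toOp_symm_omega_adelicSiegelLiftConj (g : Sp𝔸) (q : adelicMp F (Fin n) T)
    (hqc : q ∈ adelicMpCont F (Fin n) T) (hq : MpPsi.proj _ q = g) (j : G →* Sp𝔸)
    (hj : ∀ x : G, g⁻¹ * j x * g ∈ siegelParabolicPi T) (x : G) (Φ : piSchwartzBruhat F (Fin n)) :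
    (((MpPsi.toOp (adelicSchrodinger F (Fin n) T) q)⁻¹
        (adelicMpCont.omega F (Fin n) T (adelicSiegelLiftConj hT g q hqc hq j hj x) Φ) : piSchwartzBruhat F (Fin n)) :
        (Fin n → 𝔸F) → ℂ) 0 =
      ((((MpPsi.toOp (adelicSchrodinger F (Fin n) T) q)⁻¹ Φ) : piSchwartzBruhat F (Fin n)) : (Fin n → 𝔸F) → ℂ) 0 := by
  have h := (MpPsi.mem_fixing_iff _ _ _).1 (adelicSiegelLiftConj_mem_fixing hT g q hqc hq j hj x) Φ
  simpa only [MpPsi.conjFun_apply, evalZeroLM_apply, MpPsi.toOp_apply, adelicMpCont.omega_apply,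
    omegaPsi_apply] using h

/-- **UNIQUENESS**: a homomorphism `s : G →* Mp_ψ(W_𝔸)ᶜᵒⁿᵗ` over `j` whose operators fix `δ₀ ∘ M_q⁻¹` IS
`adelicSiegelLiftConj`. [cite: Weil1964, Chap. I n° 13 p. 160; Chap. III n° 41 Thm 6 p. 193] -/
theorem eq_adelicSiegelLiftConj (g : Sp𝔸) (q : adelicMp F (Fin n) T) (hqc : q ∈ adelicMpCont F (Fin n) T)
    (hq : MpPsi.proj _ q = g) (j : G →* Sp𝔸) (hj : ∀ x : G, g⁻¹ * j x * g ∈ siegelParabolicPi T)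
    (s : G →* adelicMpCont F (Fin n) T)
    (hs : ∀ x, (s x : adelicMp F (Fin n) T) ∈ MpPsi.fixing (adelicSchrodinger F (Fin n) T)
      (MpPsi.conjFun (adelicSchrodinger F (Fin n) T) q (evalZeroLM F (Fin n) : piSchwartzBruhat F (Fin n) → ℂ)))
    (hproj : ∀ x, adelicMpCont.proj F (Fin n) T (s x) = j x) : s = adelicSiegelLiftConj hT g q hqc hq j hj := by
  ext x : 1
  apply Subtype.ext
  exact eq_forcedLiftAlong_apply (deltaRigid_adelicSchrodinger F (Fin n) T) q hq j
    (fun x => siegelParabolicPi_le_liftable F T hT (hj x))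
    ((adelicMpCont F (Fin n) T).subtype.comp s) (hs x) (hproj x)

/-- **EXISTENCE of the datum**: every `g ∈ Sp(W_𝔸)` has a lift in `Mp_ψ(W_𝔸)ᶜᵒⁿᵗ` (`adelicMpCont.proj_surjective`,
[Weil1964, Chap. III n° 37]), so a continuous… so a homomorphic section over `g P_Y(𝔸) g⁻¹ ⊇ j(G)` with values in
the group of record exists for EVERY `g`; by `adelicSiegelLiftConj_eq_of_proj_eq` it does not depend on the choice.
[cite: Weil1964, Chap. III n° 37 p. 188] -/
theorem exists_section_of_conj_into_siegelParabolicPi (g : Sp𝔸) (j : G →* Sp𝔸)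
    (hj : ∀ x : G, g⁻¹ * j x * g ∈ siegelParabolicPi T) :
    ∃ s : G →* adelicMpCont F (Fin n) T, (adelicMpCont.proj F (Fin n) T).comp s = j :=
  (adelicMpCont.proj_surjective F T hT g).elim fun q hq =>
    ⟨adelicSiegelLiftConj hT g (q : adelicMp F (Fin n) T) q.2 hq j hj,
      proj_comp_adelicSiegelLiftConj hT g (q : adelicMp F (Fin n) T) q.2 hq j hj⟩

omit hT in
/-- right multiplication by a FIXED pair is continuous for the coefficient topology of `Mp_ψ(W_𝔸)`: the coordinates
of `p c` are coordinates of `p` at transformed test data (`π(p c) w = π(p)(π(c) w)`, `ω(p c)Φ = ω(p)(ω(c)Φ)`).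
[cite: Weil1964, Chap. III n° 39 p. 189] -/
theorem continuous_mul_const_adelicMp {Z : Type*} [TopologicalSpace Z] {p : Z → adelicMp F (Fin n) T}
    (hp : Continuous p) (c : adelicMp F (Fin n) T) : Continuous fun z => p z * c := by
  rw [continuous_into_adelicMp_iff] at hp ⊢
  refine ⟨fun w => ?_, fun Φ x => ?_⟩
  · have h := hp.1 (((MpPsi.proj (adelicSchrodinger F (Fin n) T) c : Sp𝔸) : 𝕎𝔸 ≃ₗ[𝔸F] 𝕎𝔸) w)
    refine h.congr fun z => ?_
    simp only [map_mul, Subgroup.coe_mul, LinearEquiv.mul_apply]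
  · have h := hp.2 (omegaPsi (adelicSchrodinger F (Fin n) T) c Φ) x
    refine h.congr fun z => ?_
    simp only [map_mul, Module.End.mul_apply]

omit hT in
/-- hence the `π`-orbit maps of a CONJUGATE family `z ↦ q · r(z) · q⁻¹` are continuous for continuous `r`
(`continuous_proj_mul_apply` of `AdelicMetaplecticProductContinuity`). [cite: Weil1964, Chap. III n° 39 p. 189] -/
theorem continuous_proj_conj_apply {Z : Type*} [TopologicalSpace Z] (q : adelicMp F (Fin n) T)
    {r : Z → adelicMp F (Fin n) T} (hr : Continuous r) (w : 𝕎𝔸) :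
    Continuous fun z => ((MpPsi.proj (adelicSchrodinger F (Fin n) T) (q * r z * q⁻¹) : Sp𝔸) :
      𝕎𝔸 ≃ₗ[𝔸F] 𝕎𝔸) w := by
  have h := continuous_proj_mul_apply (p := fun _ : Z => q) (q := fun z => r z * q⁻¹) continuous_const
    (continuous_mul_const_adelicMp hr q⁻¹) w
  refine h.congr fun z => ?_
  simp only [mul_assoc]

/-- **continuity of the `π`-orbit maps** of the transported section along a family `z ↦ x_z` for which
`z ↦ 𝐫₀(g⁻¹ j(x_z) g)` is continuous (e.g. by `continuous_adelicSiegelLift_comp`).  The matrix coefficients are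
model-analytic and are supplied place by place by the sequels. [cite: Weil1964, Chap. III n° 37–39 pp. 188–190] -/
theorem continuous_proj_adelicSiegelLiftConj_apply {Z : Type*} [TopologicalSpace Z] (g : Sp𝔸)
    (q : adelicMp F (Fin n) T) (hqc : q ∈ adelicMpCont F (Fin n) T) (hq : MpPsi.proj _ q = g) (j : G →* Sp𝔸)
    (hj : ∀ x : G, g⁻¹ * j x * g ∈ siegelParabolicPi T) (f : Z → G)
    (hf : Continuous fun z => adelicSiegelLift F T hT ⟨g⁻¹ * j (f z) * g, hj (f z)⟩) (w : 𝕎𝔸) :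
    Continuous fun z => ((adelicMpCont.proj F (Fin n) T (adelicSiegelLiftConj hT g q hqc hq j hj (f z)) : Sp𝔸) :
      𝕎𝔸 ≃ₗ[𝔸F] 𝕎𝔸) w := by
  have h := continuous_proj_conj_apply q hf w
  refine h.congr fun z => ?_
  simp only [adelicMpCont.proj_apply, coe_adelicSiegelLiftConj, adelicSiegelLiftConj'_apply]

end Adelic

end Literature.NumberTheory.Weil1964

end
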